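import Summits.BirchSwinnertonDyer.Rank1Residual.Additive.CongruentPartnerMainConjectureX3Gord
import Summits.BirchSwinnertonDyer.Rank1Residual.Additive.CongruentPartnerBranchPAdicGrossZagierIff
import Summits.BirchSwinnertonDyer.Rank1Residual.Additive.X3GordBranchPAdicGrossZagierIff
import Summits.BirchSwinnertonDyer.Rank1Residual.AdditivePotMult.PotMultBudgetRankZeroEnds
import Summits.BirchSwinnertonDyer.Rank1Residual.Additive.BranchPAdicGrossZagierConverseNoRider
import Summits.BirchSwinnertonDyer.Rank1Residual.Additive.GordBranchCertificateCurrencies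
import HarnessLib

/-!
# T-E3g (ii)(iii) on X3♯(G-ord) ∩ `I₀*` (REDUCIBLE `E[p]`), analytic rank one: the partner-free Route-G
# inputs [index-`b` UNIT coefficient `BranchUnitCoeffAt W p b` + budget `BudgetLeLambdaAt p W b`] (FILE 1's
# K-OUT over Wuthrich Thm. 16) and the one-sided analytic bit `[T¹](ϖ·B) ≠ 0` DISCHARGE both non-published
# hypotheses of n1011-p01's X3 IMC-version iffs — the typed LOWER `hdiv` and the Schneider rider `hSall` —
# leaving `BSD(E,p) ⟺ ∀ (B)-data, the typed branch p-adic Gross–Zagier`, and the EXACT identity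
# `ord_p #Ш(E) + ord_p Reg_p(E,Dh) + ord_p ∏c_ℓ + ord_p ℓ = v₁ + 1 + 2·ord_p #E(ℚ)_tors` — the X3♯(G-ord)
# twins of p01's `CongruentPartnerBranchPAdicGrossZagierIff.lean` (team n1011, seat n1011-p06 gen 3,
# OWNERS row T-E3gX3 = lead GEN 6 R5-31 deal (β); FILE 3 of 3)

HONEST FRAMING (cell `b2b-bsdres`, run/shared/lean/b2b/bsd-rank1-residual/, verbatim in every
file): the goal of the cell is to DELETE the COMBINATION-SHAPED residual classes of the
Birch–Swinnerton-Dyer formula for ALL analytic-rank `≤ 1` elliptic curves over `ℚ` — "full BSD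
formula for every rank `≤ 1` curve in class `C`" assembled STRICTLY from published theorems — so
that the rank-`≤ 1` remainder becomes exactly the CONSTRUCTION-SHAPED classes, which are TYPED
(missing-input `Prop`s), NOT attempted. This is not "finishing BSD". Team n1011 (RESIDUAL-MAP §I
O7-ord, the X3♯(G-ord) share: `E[p]` REDUCIBLE, additive potentially good ordinary of type (G) at
`p`, defect `e = 2`, `r_an = 1`): research route on CONSTRUCTION-SHAPED classes (O7 OPEN, X3♯(G-ord));
prove what is provable now; no claim beyond stated classes; census output = EVIDENCE / conjecture
items, never a Literature fact; labels and RESIDUAL-MAP marks UNCHANGED; nothing is booked. THEOREMS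
ONLY (no definition, no named fact, no `_holds`). TYPED inputs (hypotheses, NOT re-declared):
`BranchPAdicGrossZagier[Odd]At W p Dh` (p01, the residue — O7-ord), `BranchUnitCoeffAt W p b` +
`BudgetLeLambdaAt p W b` (p10; ENGINE value / per-curve bound — on X3 the budget has NO printed EPW
discharge, flag `X3-budget-no-EPW` ≡ r2's `X3-budget-unprinted`, ROUTE-2 §II.13–14, FILE 1), `BranchCoeffOneNeZeroAt W p` (`[T¹](ϖ·B) ≠ 0`, additive-p2).
PUBLISHED binders: Wuthrich 2014 Thm. 16 half-eigen reading `hWu`, `hmod`, `hmodD`, `hGZK`, Delbourgo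
(A)+(B) `hDel` / AT 3 `hDel3`. ROW binders kept: `hcm : ¬ W.HasCM` (on X3 there is NO Serre discharge —
`E[p]` is reducible; A175 needs it), `hna : ReductionNonAnomalous W p`. NO image hypothesis, NO tower,
NO Kolyvagin anywhere. OUTPUT IS NOT `BSD_p`: the typed `p`-adic Gross–Zagier (O7-ord) stays the residue.

## What

* §1 `ClassX3Gord.forall_schneider_of_wuthrichHalf_of_coeffOneNeZero` — `∀ Dh, LeadingTermClauses →
  Schneider` from Wuthrich + `[T¹](ϖ·B) ≠ 0` (ONE line over additive-p2's
  `ClassX3Gord.schneider_of_wuthrichHalf_of_ne_zero`; the `hSall` input of p01's X3 iffs);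
  `ClassX3Gord.schneider_and_padicVal_identity_rankOne_of_wuthrichHalf_of_coeffCert_of_budget` — the EXACT
  `v₁`-identity per admissible datum (FILE 1's `…mainConjecture_of_wuthrichHalf_of_coeffCert_of_budget` +
  p01's cell-agnostic rider `schneider_and_padicVal_identity_rankOne_of_charIdeal_eq_span_of_iota_eq`).
* §2 CAPSTONES: `ClassX3Gord.bsdp_iff_forall_branchPAdicGrossZagier[Odd]At_of_wuthrichHalf_of_coeffCert_of_budget`
  (even; odd `p ≥ 7`) and `ClassX3Gord.bsdp_three_iff_…_of_coeffCert_of_budget` (`p = 3`):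
  `BSDp W p ↔ ∀ Dh, LeadingTermClauses W p Dh → BranchPAdicGrossZagier[Odd]At W p Dh` with p01's
  `hdiv :=` FILE 1's K-OUT (`ClassX3Gord.chiBranchLowerDivisibility[Odd]At_of_wuthrichHalf_of_coeffCert_of_budget`)
  and `hSall :=` §1. With p01's X4♯(G-ord) file, p07-g3's (M) FILE 2c and p12's X3♯(M) twins, the
  index-`n₀` rank-one reach of Route G now stands on EVERY semistable-twist row type of O7-ord.
* §3 MINIMAL rank-one rows (index `1 = rank E(ℚ)`): with additive-p2's index-1 certificate
  `BranchUnitCertificateAt W p` the budget input DISAPPEARS — `BudgetLeLambdaAt p W 1` is p07-g3's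
  reduction- and image-agnostic `AdditivePotMult.budgetLeLambdaAt_of_le_mordellWeilRank` (`1 ≤ rank E(ℚ)` by
  GZK) and `[T¹](ϖ·B) ≠ 0` is the certificate's weak form — so `BSDp W p ↔ ∀ Dh, LeadingTermClauses →
  BranchPAdicGrossZagier[Odd]At` on X3♯(G-ord) certificate rows from Wuthrich + Delbourgo + ONE finite
  `p`-adic certificate (`ClassX3Gord.bsdp[_three]_iff_forall_branchPAdicGrossZagier[Odd]At_of_wuthrichHalf_of_cert`; the bridge
  `branchUnitCoeffAt_one_of_branchUnitCertificateAt` is additive-p2 gen 20's `GordBranchCertificateCurrencies.lean`, BY NAME;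
  the ∀-(B)-data companions of additive-p2's / p17's per-datum CERT iffs `…At_iff_bsdp_of_wuthrichHalf_of_cert`).
* §4 the ⇒ direction ALONE (mirror of p01's §4 append): `ClassX3Gord.forall_branchPAdicGrossZagier[Odd]At_of_bsdp_of_wuthrichHalf_of_coeffCert_of_budget`
  — `BSDp W p` + index-`b` unit coefficient + budget ⟹ `∀ Dh, LeadingTermClauses → BranchPAdicGrossZagier[Odd]At`,
  BIT-FREE (no `[T¹] ≠ 0`), RIDER-FREE, DELBOURGO-FREE (no `hDel`/`hDel3`: the clauses are only a shape on
  the given `Dh`), `hcm`-FREE, `he`-FREE, EVERY odd `p` (`p = 3` included on the odd branch): p01's (vii)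
  `ClassX3Gord.…_of_wuthrichHalf_noRider` ∘ FILE 1's K-OUT. HONEST: the bit and Delbourgo (A)+(B) are needed
  only for ⇐.

References: C. Wuthrich, Doc. Math. 19 (2014) Thm. 16 (p. 397) [Wuthrich2014]; D. Delbourgo, J. Number
Theory 95 (2002) Thm. (A), (B) (p. 40), Hypothesis p. 39 [Delbourgo2002]; M. Emerton, R. Pollack,
T. Weston, Invent. Math. 163 (2006) Cor. 3.2.5, Thm. 3.1.1 (shape of the budget; printed for ρ̄
irreducible; nothing asserted) [EmertonPollackWeston2006]; B. Mazur, J. Tate, J. Teitelbaum, Invent.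
Math. 84 (1986) §I.13–I.14 [MazurTateTeitelbaum1986Invent]; R. L. Miller, LMS J. Comput. Math. 14 (2011)
Def. 1.1 [Miller2011LMS]; L. Washington, GTM 83 §7.1, §13.2 [Washington1997].
-/

noncomputable section

open scoped Classical MatrixGroups ModularForm NumberField

open CongruenceSubgroup WeierstrassCurve NumberField Literature.NumberTheory.EllipticCurves
  Literature.NumberTheory.EllipticCurves.ModularForms
  Literature.NumberTheory.EllipticCurves.Rank1Residual
  Literature.NumberTheory.EllipticCurves.Rank1Residual.Typed
  Literature.NumberTheory.EllipticCurves.Delbourgo2002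
  Literature.NumberTheory.GaloisRepresentations
  IsDedekindDomain

namespace Summit.BirchSwinnertonDyer.Rank1Residual.Additive

variable {W : WeierstrassCurve ℚ} [W.IsElliptic] [W.IsGloballyMinimal] {p : ℕ} [hp : Fact p.Prime]

/-! ### §1 X3♯(G-ord) ∩ `I₀*`: Schneider from `[T¹](ϖ·B) ≠ 0`; the `v₁`-identity (NO image hypothesis) -/

/-- **Schneider for EVERY (B)-datum on X3♯(G-ord) ∩ `I₀*`, `r_an = 1`, EVERY odd `p` (`p = 3` included),
from the one-sided analytic bit `[T¹](ϖ·B) ≠ 0`** (`BranchCoeffOneNeZeroAt W p`) and Wuthrich's half —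
the `hSall` input of p01's X3 IMC-version iffs, ONE line over additive-p2's
`ClassX3Gord.schneider_of_wuthrichHalf_of_ne_zero` (reducible `E[p]`: NO tower, NO `5 ≤ p`).
[cite: Wuthrich2014, Thm. 16 (p. 397)] [cite: Delbourgo2002, Theorem (B) (p. 40)] -/
theorem ClassX3Gord.forall_schneider_of_wuthrichHalf_of_coeffOneNeZero
    (hWu : Wuthrich2014.thm16_halfEigenCharIdeal_dvd_cyclotomicPrime)
    (hmodD : nonempty_modularParametrizationData)
    (hGZK : rank_eq_analyticRank_of_analyticRank_le_one)
    (hX : ClassX3Gord W p) (hp2 : p ≠ 2) (he : semistabilityIndex W p = 2)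
    (hr : W.analyticRank = 1) (hne : BranchCoeffOneNeZeroAt W p) :
    ∀ Dh : PAdicHeightData W p, LeadingTermClauses W p Dh → SchneiderConjecture Dh :=
  fun _ hB ↦ hX.schneider_of_wuthrichHalf_of_ne_zero hWu hmodD hGZK hp2 he hr hne hB

/-- **T-E3g (ii) on the REDUCIBLE rows: the EXACT `v₁`-identity per admissible datum.** X3♯(G-ord) ∩
`I₀*`, `r_an = 1`, EVERY odd `p`; Wuthrich's half + the index-`b` unit coefficient + the budget (FILE 1's
K-E: `char_Λ X = (g)`, `ι g = C(u·ϖ)·B`) + `[T¹](ϖ·B) ≠ 0` for THIS datum ⟹ for every (B)-datum `Dh`: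
Schneider and `ord_p #Ш(E) + ord_p Reg_p(E,Dh) + ord_p ∏c_ℓ + ord_p ℓ = v_p([T¹](ϖ·B)) + 1 + 2·ord_p #E(ℚ)_tors`
(`ℓ ∣ p²`, `= 1` off the anomalous rows; `Ш(E)` finite by GZK; p01's cell-agnostic rider
`schneider_and_padicVal_identity_rankOne_of_charIdeal_eq_span_of_iota_eq`). NO image hypothesis.
[cite: Delbourgo2002, Theorem (B) (p. 40)] [cite: Wuthrich2014, Thm. 16 (p. 397)]
[cite: EmertonPollackWeston2006, Cor. 3.2.5 (shape of the budget; printed for ρ̄ irreducible)] -/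
theorem ClassX3Gord.schneider_and_padicVal_identity_rankOne_of_wuthrichHalf_of_coeffCert_of_budget
    (hWu : Wuthrich2014.thm16_halfEigenCharIdeal_dvd_cyclotomicPrime)
    (hGZK : rank_eq_analyticRank_of_analyticRank_le_one)
    (hX : ClassX3Gord W p) (hp2 : p ≠ 2) (hr : W.analyticRank = 1)
    {b : ℕ} (hcert : BranchUnitCoeffAt W p b) (hbud : BudgetLeLambdaAt p W b)
    (V : WeierstrassCurve ℚ) [V.IsElliptic] [V.IsGloballyMinimal] (C : VariableChange ℚ)
    (hC : C • V.quadraticTwist ((-1 : ℚ) ^ (p / 2) * p) = W) (hV : GoodOrd V p)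
    {N : ℕ} [NeZero N] {f : CuspForm (Gamma0 N) 2} (hf : IsNewformOf V f) (ϖ : ℚ)
    (hϖ : if Even (p / 2) then (ϖ : ℝ) * V.realPeriodRat = plusPeriod f
      else (ϖ : ℝ) * V.imaginaryPeriodRat = minusPeriod f)
    (hne : PowerSeries.coeff 1 (PowerSeries.C (ϖ : ℚ_[p]) *
      (if Even (p / 2) then padicLFunctionBranch f ((unitRoot V p : ℤ_[p]) : ℚ_[p]) (p / 2)
        else padicLFunctionMinusBranch f ((unitRoot V p : ℤ_[p]) : ℚ_[p]) (p / 2))) ≠ 0)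
    {Dh : PAdicHeightData W p} (hB : LeadingTermClauses W p Dh) :
    SchneiderConjecture Dh ∧
      ∃ ℓ : ℕ, ℓ ∣ p ^ 2 ∧ (ReductionNonAnomalous W p → ℓ = 1) ∧
        (padicValNat p W.shaOrder : ℤ) + (padicRegulator Dh).valuation +
            padicValNat p W.tamagawaProduct + padicValNat p ℓ =
          (PowerSeries.coeff 1 (PowerSeries.C (ϖ : ℚ_[p]) *
              (if Even (p / 2) then padicLFunctionBranch f ((unitRoot V p : ℤ_[p]) : ℚ_[p]) (p / 2)
                else padicLFunctionMinusBranch f ((unitRoot V p : ℤ_[p]) : ℚ_[p]) (p / 2)))).valuation +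
            1 + 2 * padicValNat p W.torsionOrder := by
  obtain ⟨hmw, hfinSha⟩ := hGZK W (by rw [hr])
  have hr1 : W.mordellWeilRank = 1 := by rw [hmw, hr]
  haveI : Finite W.sha := hfinSha
  obtain ⟨κ, γ, hκ, hγ, hγ', D, fE, -⟩ := exists_cyclotomic_dualData_generator W p
  haveI : Module.Finite (IwasawaAlgebra p) D.X :=
    SelmerDualData.module_finite_of_isCyclotomic (W := W) (κ := κ) hκ D hγ
  obtain ⟨hXt, g, u, hchar, hι, -, -⟩ := hX.mainConjecture_of_wuthrichHalf_of_coeffCert_of_budget hWu hp2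
    hcert hbud V C hC hV hκ hγ hγ' hf D ϖ hϖ
  obtain ⟨hS, -, ℓ, hℓp, hℓ1, hid⟩ :=
    schneider_and_padicVal_identity_rankOne_of_charIdeal_eq_span_of_iota_eq hp2 hr1 hB hκ hγ hγ' D hXt
      hchar hι hne
  refine ⟨hS, ℓ, hℓp, hℓ1, ?_⟩
  rw [padicValNat_card_addPrimaryComponent] at hid
  exact hid

/-! ### §2 CAPSTONES (T-E3g (iii) on X3♯(G-ord)): p01's IMC-version iffs with `hdiv` and `hSall` DISCHARGED -/

/-- **CAPSTONE, even branch.** X3♯(G-ord) ∩ `I₀*`, `p ≡ 1 (mod 4)`, `r_an = 1`, non-CM (`hcm` stays a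
binder: `E[p]` reducible, no Serre), non-anomalous; GIVEN Wuthrich's half, Delbourgo (A)+(B) (A175),
modularity, `hmodD`, GZK, the index-`b` unit coefficient `BranchUnitCoeffAt W p b` with the budget
`BudgetLeLambdaAt p W b` (⟹ the typed LOWER, FILE 1 K-OUT) and `[T¹](ϖ·B) ≠ 0` (⟹ Schneider ∀ (B)-data):
**`BSD(E,p) ⟺ ∀ (B)-data, BranchPAdicGrossZagierAt`** — p01's
`ClassX3Gord.bsdp_iff_forall_branchPAdicGrossZagierAt_of_chiBranchLower_of_wuthrichHalf` with both
non-published hypotheses replaced by finite `p`-adic certificates. NO image hypothesis.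
[cite: Delbourgo2002, Theorem (A), (B), Example (p. 40)] [cite: Wuthrich2014, Thm. 16 (p. 397)]
[cite: Miller2011LMS, Def. 1.1] -/
theorem ClassX3Gord.bsdp_iff_forall_branchPAdicGrossZagierAt_of_wuthrichHalf_of_coeffCert_of_budget
    (hDel : Delbourgo2002.mainTheorem) (hWu : Wuthrich2014.thm16_halfEigenCharIdeal_dvd_cyclotomicPrime)
    (hmod : hasEntireLFunction_rat) (hmodD : nonempty_modularParametrizationData)
    (hGZK : rank_eq_analyticRank_of_analyticRank_le_one) (hX : ClassX3Gord W p)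
    (he : semistabilityIndex W p = 2) (hp4 : p % 4 = 1) (hcm : ¬ W.HasCM) (hna : ReductionNonAnomalous W p)
    (hr : W.analyticRank = 1)
    {b : ℕ} (hcert : BranchUnitCoeffAt W p b) (hbud : BudgetLeLambdaAt p W b)
    (hne : BranchCoeffOneNeZeroAt W p) :
    BSDp W p ↔ ∀ Dh : PAdicHeightData W p, LeadingTermClauses W p Dh → BranchPAdicGrossZagierAt W p Dh :=
  hX.bsdp_iff_forall_branchPAdicGrossZagierAt_of_chiBranchLower_of_wuthrichHalf hDel hWu hmod hmodD hGZK he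
    hp4 hcm hna hr (hX.chiBranchLowerDivisibilityAt_of_wuthrichHalf_of_coeffCert_of_budget hWu hcert hbud)
    (hX.forall_schneider_of_wuthrichHalf_of_coeffOneNeZero hWu hmodD hGZK (by omega) he hr hne)

/-- **CAPSTONE, odd branch `p ≥ 7`.** X3♯(G-ord) ∩ `I₀*`, `p ≡ 3 (mod 4)`, `p ≥ 5`, `r_an = 1`, non-CM,
non-anomalous; same inputs on the odd branch: **`BSD(E,p) ⟺ ∀ (B)-data, BranchPAdicGrossZagierOddAt`**.
NO image hypothesis. [cite: Delbourgo2002, Theorem (A), (B), Example (p. 40)]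
[cite: Wuthrich2014, Thm. 16 (p. 397)] [cite: Miller2011LMS, Def. 1.1] -/
theorem ClassX3Gord.bsdp_iff_forall_branchPAdicGrossZagierOddAt_of_wuthrichHalf_of_coeffCert_of_budget
    (hDel : Delbourgo2002.mainTheorem) (hWu : Wuthrich2014.thm16_halfEigenCharIdeal_dvd_cyclotomicPrime)
    (hmod : hasEntireLFunction_rat) (hmodD : nonempty_modularParametrizationData)
    (hGZK : rank_eq_analyticRank_of_analyticRank_le_one) (hX : ClassX3Gord W p)
    (he : semistabilityIndex W p = 2) (hp4 : p % 4 = 3) (hp5 : 5 ≤ p) (hcm : ¬ W.HasCM)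
    (hna : ReductionNonAnomalous W p) (hr : W.analyticRank = 1)
    {b : ℕ} (hcert : BranchUnitCoeffAt W p b) (hbud : BudgetLeLambdaAt p W b)
    (hne : BranchCoeffOneNeZeroAt W p) :
    BSDp W p ↔
      ∀ Dh : PAdicHeightData W p, LeadingTermClauses W p Dh → BranchPAdicGrossZagierOddAt W p Dh :=
  hX.bsdp_iff_forall_branchPAdicGrossZagierOddAt_of_chiBranchLowerOdd_of_wuthrichHalf hDel hWu hmod hmodD
    hGZK he hp4 hp5 hcm hna hr
    (hX.chiBranchLowerDivisibilityOddAt_of_wuthrichHalf_of_coeffCert_of_budget hWu hcert hbud)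
    (hX.forall_schneider_of_wuthrichHalf_of_coeffOneNeZero hWu hmodD hGZK (by omega) he hr hne)

/-- **CAPSTONE, odd branch `p = 3`.** X3♯(G-ord) at `3` (`e_E(3) = 2` automatic for type (G) at `3`),
`r_an = 1`, non-CM, non-anomalous, over p16's `Delbourgo2002.mainTheorem_three`; the index-`b` 3-adic
unit coefficient + budget at `3` (FILE 1 K-OUT) and `[T¹](ϖ·B⁻) ≠ 0`: **`BSD(E,3) ⟺ ∀ (B)-data,
BranchPAdicGrossZagierOddAt W 3`**. NO image hypothesis, NO tower. [cite: Delbourgo2002, Theorem (A), (B) (p. 40)]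
[cite: Wuthrich2014, Thm. 16 (p. 397)] [cite: Miller2011LMS, Def. 1.1] -/
theorem ClassX3Gord.bsdp_three_iff_forall_branchPAdicGrossZagierOddAt_of_wuthrichHalf_of_coeffCert_of_budget
    (hDel3 : Delbourgo2002.mainTheorem_three)
    (hWu : Wuthrich2014.thm16_halfEigenCharIdeal_dvd_cyclotomicPrime)
    (hmod : hasEntireLFunction_rat) (hmodD : nonempty_modularParametrizationData)
    (hGZK : rank_eq_analyticRank_of_analyticRank_le_one) (hX : ClassX3Gord W 3)
    (hcm : ¬ W.HasCM) (hna : ReductionNonAnomalous W 3) (hr : W.analyticRank = 1)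
    {b : ℕ} (hcert : BranchUnitCoeffAt W 3 b) (hbud : BudgetLeLambdaAt 3 W b)
    (hne : BranchCoeffOneNeZeroAt W 3) :
    BSDp W 3 ↔
      ∀ Dh : PAdicHeightData W 3, LeadingTermClauses W 3 Dh → BranchPAdicGrossZagierOddAt W 3 Dh :=
  have he : semistabilityIndex W 3 = 2 := semistabilityIndex_eq_two_of_typeG_three W hX.typeGOrd.typeG hX.addv
  hX.bsdp_three_iff_forall_branchPAdicGrossZagierOddAt_of_chiBranchLowerOdd_of_wuthrichHalf hDel3 hWu hmod
    hmodD hGZK hcm hna hr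
    (hX.chiBranchLowerDivisibilityOddAt_of_wuthrichHalf_of_coeffCert_of_budget hWu hcert hbud)
    (hX.forall_schneider_of_wuthrichHalf_of_coeffOneNeZero hWu hmodD hGZK (by norm_num) he hr hne)

/-! ### §3 MINIMAL rank-one rows: the index-1 certificate, NO budget input (discharged by the rank) -/

/-- **MINIMAL rows, even branch.** X3♯(G-ord) ∩ `I₀*`, `p ≡ 1 (mod 4)`, `r_an = 1`, non-CM,
non-anomalous, with additive-p2's index-1 certificate `BranchUnitCertificateAt W p`: **`BSD(E,p) ⟺ ∀
(B)-data, BranchPAdicGrossZagierAt`** — NO budget input (`BudgetLeLambdaAt p W 1` from `1 ≤ rank E(ℚ)`,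
p07-g3's `AdditivePotMult.budgetLeLambdaAt_of_le_mordellWeilRank`; `[T¹](ϖ·B) ≠ 0` from the certificate).
[cite: Delbourgo2002, Theorem (A), (B) (p. 40)] [cite: Wuthrich2014, Thm. 16 (p. 397)]
[cite: GreenbergLNM1716, §3 Lemma 3.1 (T^{rank} ∣ char)] [cite: Miller2011LMS, Def. 1.1] -/
theorem ClassX3Gord.bsdp_iff_forall_branchPAdicGrossZagierAt_of_wuthrichHalf_of_cert
    (hDel : Delbourgo2002.mainTheorem) (hWu : Wuthrich2014.thm16_halfEigenCharIdeal_dvd_cyclotomicPrime)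
    (hmod : hasEntireLFunction_rat) (hmodD : nonempty_modularParametrizationData)
    (hGZK : rank_eq_analyticRank_of_analyticRank_le_one) (hX : ClassX3Gord W p)
    (he : semistabilityIndex W p = 2) (hp4 : p % 4 = 1) (hcm : ¬ W.HasCM) (hna : ReductionNonAnomalous W p)
    (hr : W.analyticRank = 1) (hcert : BranchUnitCertificateAt W p) :
    BSDp W p ↔ ∀ Dh : PAdicHeightData W p, LeadingTermClauses W p Dh → BranchPAdicGrossZagierAt W p Dh := by
  obtain ⟨hmw, -⟩ := hGZK W (by rw [hr])
  have hr1 : 1 ≤ W.mordellWeilRank := by rw [hmw, hr]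
  exact hX.bsdp_iff_forall_branchPAdicGrossZagierAt_of_wuthrichHalf_of_coeffCert_of_budget hDel hWu hmod
    hmodD hGZK he hp4 hcm hna hr (branchUnitCoeffAt_one_of_branchUnitCertificateAt hcert)
    (AdditivePotMult.budgetLeLambdaAt_of_le_mordellWeilRank hr1)
    (branchCoeffOneNeZeroAt_of_branchUnitCertificateAt hcert)

/-- **MINIMAL rows, odd branch `p ≥ 7`.** X3♯(G-ord) ∩ `I₀*`, `p ≡ 3 (mod 4)`, `p ≥ 5`, `r_an = 1`,
non-CM, non-anomalous, index-1 certificate: **`BSD(E,p) ⟺ ∀ (B)-data, BranchPAdicGrossZagierOddAt`** —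
NO budget input. [cite: Delbourgo2002, Theorem (A), (B) (p. 40)] [cite: Wuthrich2014, Thm. 16 (p. 397)]
[cite: GreenbergLNM1716, §3 Lemma 3.1 (T^{rank} ∣ char)] [cite: Miller2011LMS, Def. 1.1] -/
theorem ClassX3Gord.bsdp_iff_forall_branchPAdicGrossZagierOddAt_of_wuthrichHalf_of_cert
    (hDel : Delbourgo2002.mainTheorem) (hWu : Wuthrich2014.thm16_halfEigenCharIdeal_dvd_cyclotomicPrime)
    (hmod : hasEntireLFunction_rat) (hmodD : nonempty_modularParametrizationData)
    (hGZK : rank_eq_analyticRank_of_analyticRank_le_one) (hX : ClassX3Gord W p)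
    (he : semistabilityIndex W p = 2) (hp4 : p % 4 = 3) (hp5 : 5 ≤ p) (hcm : ¬ W.HasCM)
    (hna : ReductionNonAnomalous W p) (hr : W.analyticRank = 1) (hcert : BranchUnitCertificateAt W p) :
    BSDp W p ↔
      ∀ Dh : PAdicHeightData W p, LeadingTermClauses W p Dh → BranchPAdicGrossZagierOddAt W p Dh := by
  obtain ⟨hmw, -⟩ := hGZK W (by rw [hr])
  have hr1 : 1 ≤ W.mordellWeilRank := by rw [hmw, hr]
  exact hX.bsdp_iff_forall_branchPAdicGrossZagierOddAt_of_wuthrichHalf_of_coeffCert_of_budget hDel hWu hmod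
    hmodD hGZK he hp4 hp5 hcm hna hr (branchUnitCoeffAt_one_of_branchUnitCertificateAt hcert)
    (AdditivePotMult.budgetLeLambdaAt_of_le_mordellWeilRank hr1)
    (branchCoeffOneNeZeroAt_of_branchUnitCertificateAt hcert)

/-- **MINIMAL rows, odd branch `p = 3`.** X3♯(G-ord) at `3`, `r_an = 1`, non-CM, non-anomalous, index-1
3-adic certificate on the `ω`-branch of `E^{(−3)}`, over p16's `Delbourgo2002.mainTheorem_three`: **`BSD(E,3)
⟺ ∀ (B)-data, BranchPAdicGrossZagierOddAt W 3`** — NO budget input, NO image hypothesis, NO tower.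
[cite: Delbourgo2002, Theorem (A), (B) (p. 40)] [cite: Wuthrich2014, Thm. 16 (p. 397)]
[cite: GreenbergLNM1716, §3 Lemma 3.1 (T^{rank} ∣ char)] [cite: Miller2011LMS, Def. 1.1] -/
theorem ClassX3Gord.bsdp_three_iff_forall_branchPAdicGrossZagierOddAt_of_wuthrichHalf_of_cert
    (hDel3 : Delbourgo2002.mainTheorem_three)
    (hWu : Wuthrich2014.thm16_halfEigenCharIdeal_dvd_cyclotomicPrime)
    (hmod : hasEntireLFunction_rat) (hmodD : nonempty_modularParametrizationData)
    (hGZK : rank_eq_analyticRank_of_analyticRank_le_one) (hX : ClassX3Gord W 3)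
    (hcm : ¬ W.HasCM) (hna : ReductionNonAnomalous W 3) (hr : W.analyticRank = 1)
    (hcert : BranchUnitCertificateAt W 3) :
    BSDp W 3 ↔
      ∀ Dh : PAdicHeightData W 3, LeadingTermClauses W 3 Dh → BranchPAdicGrossZagierOddAt W 3 Dh := by
  obtain ⟨hmw, -⟩ := hGZK W (by rw [hr])
  have hr1 : 1 ≤ W.mordellWeilRank := by rw [hmw, hr]
  exact hX.bsdp_three_iff_forall_branchPAdicGrossZagierOddAt_of_wuthrichHalf_of_coeffCert_of_budget hDel3 hWu
    hmod hmodD hGZK hcm hna hr (branchUnitCoeffAt_one_of_branchUnitCertificateAt hcert)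
    (AdditivePotMult.budgetLeLambdaAt_of_le_mordellWeilRank hr1)
    (branchCoeffOneNeZeroAt_of_branchUnitCertificateAt hcert)

/-! ### §4 The ⇒ direction ALONE: bit-free, rider-free, Delbourgo-free, every odd `p` (p01's (vii) ∘ FILE 1) -/

/-- **X3♯(G-ord), even branch, ⇒ only: `BSD(E,p)` + index-`b` unit coefficient + budget ⟹ the typed
even-branch `p`-adic Gross–Zagier for EVERY (B)-datum** — rank one, non-anomalous; NO `[T¹](ϖ·B) ≠ 0`, NO
rider, NO Delbourgo fact, NO `hcm`, NO `he`; the guard `p ≡ 1 (mod 4)` sits inside the typed statement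
(p01's rider-free converse `ClassX3Gord.branchPAdicGrossZagierAt_of_bsdp_of_chiBranchLower_of_wuthrichHalf_noRider`
with `hdiv :=` FILE 1's K-OUT). [cite: Wuthrich2014, Thm. 16 (p. 397)] [cite: Delbourgo2002, Theorem (B) (p. 40) (shape of the clauses only)]
[cite: Miller2011LMS, Def. 1.1] -/
theorem ClassX3Gord.forall_branchPAdicGrossZagierAt_of_bsdp_of_wuthrichHalf_of_coeffCert_of_budget
    (hWu : Wuthrich2014.thm16_halfEigenCharIdeal_dvd_cyclotomicPrime) (hmod : hasEntireLFunction_rat)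
    (hX : ClassX3Gord W p) (hr : W.analyticRank = 1) (hna : ReductionNonAnomalous W p) (hbsd : BSDp W p)
    {b : ℕ} (hcert : BranchUnitCoeffAt W p b) (hbud : BudgetLeLambdaAt p W b) :
    ∀ Dh : PAdicHeightData W p, LeadingTermClauses W p Dh → BranchPAdicGrossZagierAt W p Dh :=
  fun _ hB ↦ hX.branchPAdicGrossZagierAt_of_bsdp_of_chiBranchLower_of_wuthrichHalf_noRider hWu hmod hr hna
    hbsd (hX.chiBranchLowerDivisibilityAt_of_wuthrichHalf_of_coeffCert_of_budget hWu hcert hbud) hB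

/-- **X3♯(G-ord), ODD branch (`p ≡ 3 (mod 4)`, `p = 3` included), ⇒ only: `BSD(E,p)` + index-`b` unit
coefficient + budget ⟹ the typed odd-branch `p`-adic Gross–Zagier for EVERY (B)-datum** — rank one,
non-anomalous; bit-free, rider-free, Delbourgo-free, NO `hcm`, NO `he`, NO `5 ≤ p`.
[cite: Wuthrich2014, Thm. 16 (p. 397)] [cite: Delbourgo2002, Theorem (B) (p. 40) (shape of the clauses only)]
[cite: Miller2011LMS, Def. 1.1] -/
theorem ClassX3Gord.forall_branchPAdicGrossZagierOddAt_of_bsdp_of_wuthrichHalf_of_coeffCert_of_budget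
    (hWu : Wuthrich2014.thm16_halfEigenCharIdeal_dvd_cyclotomicPrime) (hmod : hasEntireLFunction_rat)
    (hX : ClassX3Gord W p) (hr : W.analyticRank = 1) (hna : ReductionNonAnomalous W p) (hbsd : BSDp W p)
    {b : ℕ} (hcert : BranchUnitCoeffAt W p b) (hbud : BudgetLeLambdaAt p W b) :
    ∀ Dh : PAdicHeightData W p, LeadingTermClauses W p Dh → BranchPAdicGrossZagierOddAt W p Dh :=
  fun _ hB ↦ hX.branchPAdicGrossZagierOddAt_of_bsdp_of_chiBranchLowerOdd_of_wuthrichHalf_noRider hWu hmod hr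
    hna hbsd (hX.chiBranchLowerDivisibilityOddAt_of_wuthrichHalf_of_coeffCert_of_budget hWu hcert hbud) hB

end Summit.BirchSwinnertonDyer.Rank1Residual.Additive

end
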